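import Summits.AtomisticToContinuum.FouriersLaw.Theorems.OddSectorIrreversibilityConeScaleCorrectorStubDynkinLeftEnergyAux
import Summits.AtomisticToContinuum.FouriersLaw.Theorems.BondHeatUncertaintySubdiffusiveBondHeatSiteEnergyDynkin
import Summits.AtomisticToContinuum.FouriersLaw.Theorems.OddSectorIrreversibilityConeScaleCorrectorStubCentredCorrector
import Literature.Barriers.AtomisticToContinuum.MazurBoundBallisticOpenChain
import Literature.MathematicalPhysics.KineticTheory.PhaseSpacePoisson

/-!
# `ConeScaleCorrector` (E1), line `gamblers-ruin-defect`: stub `stub_dynkinLeftEnergy`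

Registered sub-stub (fixed N): Dynkin's identity for `E_L = H − X/(N−1)` under the constructed equilibrium kernels,
by truncation (`pinnedChain_dynkin_of_truncation`), following the tree's precedent `stub_siteEnergyDynkin`
(file `BondHeatUncertaintySubdiffusiveBondHeatSiteEnergyDynkin.lean`) with `e₀` replaced by `E_L`; the elementary
estimates (`0 ≤ E_L ≤ H`, `|L E_L| ≤ B(1 + H)²`, truncation error `≤ (A/R)(1 + H)²`) are in the companion file
`…StubDynkinLeftEnergyAux.lean`, and here `θ = 1/(2T)`, `(1 + H)² ≤ (2e^θ/θ²) e^{θH}`, CEHR (3.4).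
-/

noncomputable section

open MeasureTheory ProbabilityTheory Filter Topology Set
open scoped ENNReal NNReal BigOperators
open Literature.MathematicalPhysics.KineticTheory.HeatConduction
open Literature.Barriers.AtomisticToContinuum.OpenChain

namespace Summit.AtomisticToContinuum.FouriersLaw.Theorems.OddSectorIrreversibility

open Summit.AtomisticToContinuum.FouriersLaw.Theorems.SubdiffusiveBondHeat
open Literature.MathematicalPhysics.KineticTheory Literature.MathematicalPhysics.KineticTheory.HeatConduction.OscillatorChain

/-- **stub_dynkinLeftEnergy** (FIXED `N ≥ 2`; size M; registered sub-stub of `stub_correctorSplitting`, lead reshape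
2026-08-16). DYNKIN'S IDENTITY for the polynomially bounded observable `E_L = H − X/(N−1)` under the CONSTRUCTED
equilibrium kernels: `P_r E_L(z) − E_L(z) = ∫₀ʳ P_s(L E_L)(z) ds` for all `r ≥ 0`, `z`, with `L E_L` written as
`generator N T T E_L` (so this stub is independent of `stub_generatorLeftEnergy`). Route: truncations `E_L · χ(H/R)`
(`smoothCutoff`), `generator_mul_smoothCutoff_hamiltonian` + the pattern of `pinnedChain_abs_generator_truncSiteEnergy_sub_le`
(`|E_L| ≤ 2H`, `∂_{p₀}E_L = p₀`, `∂_{p_{N−1}}E_L = 0`, `|L E_L| ≤ B(1+H)²`), then `pinnedChain_dynkin_of_truncation`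
(Theorems/BondHeatUncertaintySubdiffusiveBondHeatSiteEnergyDynkinTruncation.lean; CEHR (3.4) moment bounds). -/
theorem stub_dynkinLeftEnergy :
    ∀ ω₂ lam β γ : ℝ, 0 < ω₂ → 0 < lam → 0 < β → 0 < γ → ∀ T : ℝ, 0 < T → ∀ N : ℕ, 2 ≤ N →
    ∀ (r : NNReal) (z : PhaseSpace N),
    (∫ y, ((pinnedChain ω₂ lam β γ).hamiltonian N y
          - energyMoment (pinnedChain ω₂ lam β γ) N y / ((N : ℝ) - 1))
        ∂((pinnedChain ω₂ lam β γ).transitionKernel N T T r z))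
      - ((pinnedChain ω₂ lam β γ).hamiltonian N z - energyMoment (pinnedChain ω₂ lam β γ) N z / ((N : ℝ) - 1)) =
    ∫ s in (0 : ℝ)..(r : ℝ),
      ∫ y, (pinnedChain ω₂ lam β γ).generator N T T
          (fun y' : PhaseSpace N => (pinnedChain ω₂ lam β γ).hamiltonian N y'
            - energyMoment (pinnedChain ω₂ lam β γ) N y' / ((N : ℝ) - 1)) y
        ∂((pinnedChain ω₂ lam β γ).transitionKernel N T T s.toNNReal z) := by
  -- adapted from `stub_siteEnergyDynkin` (Theorems/BondHeatUncertaintySubdiffusiveBondHeatSiteEnergyDynkin.lean)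
  intro ω₂ lam β γ hω hl hβ hγ T hT N hN r z
  have hN0 : 0 < N := by omega
  -- the constants
  obtain ⟨A, hA0, hA⟩ := pinnedChain_abs_generator_truncLeftEnergy_sub_le hω.le hl.le hβ.le hγ.le hN hT.le
  set θ : ℝ := 1 / (2 * T) with hθ
  have hθ0 : 0 < θ := by positivity
  have hθ1 : θ < 1 / T := by
    rw [hθ, div_lt_div_iff₀ (by positivity) hT]; nlinarith
  set B : ℝ := γ * (N * T + 2) + N * (N * ((3 + β) / 2)) with hB
  have hB0 : 0 ≤ B := by positivity
  set C₀ : ℝ := 2 * Real.exp θ / θ ^ 2 with hC₀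
  have hC₀0 : 0 ≤ C₀ := by positivity
  -- the observable, its generator image, the truncations
  set e : PhaseSpace N → ℝ := fun y => (pinnedChain ω₂ lam β γ).hamiltonian N y
    - energyMoment (pinnedChain ω₂ lam β γ) N y / ((N : ℝ) - 1) with he
  set ℓ : PhaseSpace N → ℝ := (pinnedChain ω₂ lam β γ).generator N T T e with hℓ
  set f : ℕ → PhaseSpace N → ℝ := fun n y =>
    e y * smoothCutoff ((pinnedChain ω₂ lam β γ).hamiltonian N y / (n + 1)) with hf
  have hfdef : ∀ n y, f n y = e y * smoothCutoff ((pinnedChain ω₂ lam β γ).hamiltonian N y / (n + 1)) :=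
    fun n y => rfl
  -- regularity and compact support
  have hU2 : ContDiff ℝ 2 (pinnedChain ω₂ lam β γ).U := pinnedChain_contDiff_U ω₂ lam β γ
  have hV2 : ContDiff ℝ 2 (pinnedChain ω₂ lam β γ).V := pinnedChain_contDiff_V ω₂ lam β γ
  have hH2 : ContDiff ℝ 2 ((pinnedChain ω₂ lam β γ).hamiltonian N) :=
    (pinnedChain ω₂ lam β γ).contDiff_hamiltonian hU2 hV2 N
  have he2 : ContDiff ℝ 2 e := hH2.sub ((contDiff_energyMoment_of_contDiff _ hU2 hV2).div_const _)
  have hH0 : ∀ y, 0 ≤ (pinnedChain ω₂ lam β γ).hamiltonian N y := fun y =>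
    pinnedChain_hamiltonian_nonneg hω.le hl.le hβ.le γ N y
  have hRpos : ∀ n : ℕ, (0 : ℝ) < n + 1 := fun n => by positivity
  have hR1 : ∀ n : ℕ, (1 : ℝ) ≤ n + 1 := fun n => by
    have : (0 : ℝ) ≤ n := Nat.cast_nonneg n
    linarith
  have hf2 : ∀ n, ContDiff ℝ 2 (f n) := fun n =>
    he2.mul ((contDiff_smoothCutoff (n := 2)).comp (hH2.div_const _))
  have hfs : ∀ n, HasCompactSupport (f n) := fun n => by
    refine HasCompactSupport.intro
      (pinnedChain_isCompact_setOf_hamiltonian_le hω hl.le hβ.le γ N (2 * (n + 1))) fun y hy => ?_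
    simp only [mem_setOf_eq, not_le] at hy
    have h2 : 2 ≤ (pinnedChain ω₂ lam β γ).hamiltonian N y / (n + 1) := by
      rw [le_div_iff₀ (hRpos n)]; linarith
    rw [hfdef, smoothCutoff_of_two_le h2, mul_zero]
  -- eventually the cutoff is `1`
  have hev : ∀ y, ∀ᶠ n : ℕ in atTop, smoothCutoff ((pinnedChain ω₂ lam β γ).hamiltonian N y / (n + 1)) = 1 := by
    intro y
    obtain ⟨n₀, hn₀⟩ := exists_nat_ge ((pinnedChain ω₂ lam β γ).hamiltonian N y)
    filter_upwards [eventually_ge_atTop n₀] with n hn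
    have h1 : (pinnedChain ω₂ lam β γ).hamiltonian N y / (n + 1) ≤ 1 := by
      rw [div_le_one (hRpos n)]
      have : (n₀ : ℝ) ≤ n := by exact_mod_cast hn
      linarith
    exact smoothCutoff_of_le_one h1
  -- size estimates
  have hsq : ∀ y, (1 + (pinnedChain ω₂ lam β γ).hamiltonian N y) ^ 2 ≤
      C₀ * Real.exp (θ * (pinnedChain ω₂ lam β γ).hamiltonian N y) := fun y => one_add_sq_le_exp (hH0 y) hθ0
  have hebd : ∀ y, 0 ≤ e y ∧ e y ≤ (pinnedChain ω₂ lam β γ).hamiltonian N y := fun y =>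
    pinnedChain_leftEnergy_nonneg_le hω.le hl.le hβ.le γ hN y
  have hℓb : ∀ y, |ℓ y| ≤ B * (1 + (pinnedChain ω₂ lam β γ).hamiltonian N y) ^ 2 := fun y =>
    pinnedChain_abs_generator_leftEnergy_le hω.le hl.le hβ.le hγ.le hN hT.le y
  -- the truncation error
  have herr : ∀ (n : ℕ) (y : PhaseSpace N),
      |(pinnedChain ω₂ lam β γ).generator N T T (f n) y -
          smoothCutoff ((pinnedChain ω₂ lam β γ).hamiltonian N y / (n + 1)) * ℓ y| ≤
        A / (n + 1) * (1 + (pinnedChain ω₂ lam β γ).hamiltonian N y) ^ 2 := fun n y => hA (n + 1) (hR1 n) y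
  -- the uniform exponential domination of `f_n` and `L f_n`
  have hfb : ∀ (n : ℕ) (y : PhaseSpace N),
      |f n y| ≤ (A + B + 1) * C₀ * Real.exp (θ * (pinnedChain ω₂ lam β γ).hamiltonian N y) := by
    intro n y
    obtain ⟨h0, h1⟩ := hebd y
    have hχ0 := smoothCutoff_nonneg ((pinnedChain ω₂ lam β γ).hamiltonian N y / (n + 1))
    have hχ1 := smoothCutoff_le_one ((pinnedChain ω₂ lam β γ).hamiltonian N y / (n + 1))
    have hs := hsq y
    have hHy := hH0 y
    rw [hfdef, abs_of_nonneg (mul_nonneg h0 hχ0)]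
    generalize (pinnedChain ω₂ lam β γ).hamiltonian N y = Hy at h1 hs hHy hχ0 hχ1 ⊢
    generalize smoothCutoff (Hy / (n + 1)) = c at hχ0 hχ1 ⊢
    generalize e y = E at h0 h1 ⊢
    calc E * c ≤ E := mul_le_of_le_one_right h0 hχ1
      _ ≤ 1 * (1 + Hy) ^ 2 := by nlinarith
      _ ≤ (A + B + 1) * (1 + Hy) ^ 2 := by gcongr; linarith
      _ ≤ (A + B + 1) * (C₀ * Real.exp (θ * Hy)) := by gcongr
      _ = (A + B + 1) * C₀ * Real.exp (θ * Hy) := by ring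
  have hLb : ∀ (n : ℕ) (y : PhaseSpace N), |(pinnedChain ω₂ lam β γ).generator N T T (f n) y| ≤
      (A + B + 1) * C₀ * Real.exp (θ * (pinnedChain ω₂ lam β γ).hamiltonian N y) := by
    intro n y
    have h1 := herr n y
    have h2 := hℓb y
    have hs := hsq y
    have hHy := hH0 y
    have hχ0 := smoothCutoff_nonneg ((pinnedChain ω₂ lam β γ).hamiltonian N y / (n + 1))
    have hχ1 := smoothCutoff_le_one ((pinnedChain ω₂ lam β γ).hamiltonian N y / (n + 1))
    generalize (pinnedChain ω₂ lam β γ).generator N T T (f n) y = G at h1 ⊢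
    generalize (pinnedChain ω₂ lam β γ).hamiltonian N y = Hy at h1 h2 hs hHy hχ0 hχ1 ⊢
    generalize smoothCutoff (Hy / (n + 1)) = c at hχ0 hχ1 h1 ⊢
    generalize ℓ y = l at h1 h2 ⊢
    have h3 : |c * l| ≤ B * (1 + Hy) ^ 2 := by
      rw [abs_mul, abs_of_nonneg hχ0]
      calc c * |l| ≤ 1 * |l| := mul_le_mul_of_nonneg_right hχ1 (abs_nonneg _)
        _ ≤ B * (1 + Hy) ^ 2 := by rw [one_mul]; exact h2
    have h4 : A / (n + 1) * (1 + Hy) ^ 2 ≤ A * (1 + Hy) ^ 2 :=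
      mul_le_mul_of_nonneg_right (div_le_self hA0 (hR1 n)) (sq_nonneg _)
    calc |G| ≤ |G - c * l| + |c * l| := by
          have := abs_add_le (G - c * l) (c * l); rwa [sub_add_cancel] at this
      _ ≤ A * (1 + Hy) ^ 2 + B * (1 + Hy) ^ 2 := add_le_add (h1.trans h4) h3
      _ ≤ (A + B + 1) * (1 + Hy) ^ 2 := by nlinarith [sq_nonneg (1 + Hy)]
      _ ≤ (A + B + 1) * (C₀ * Real.exp (θ * Hy)) := by gcongr
      _ = (A + B + 1) * C₀ * Real.exp (θ * Hy) := by ring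
  -- pointwise convergence of `f_n` and `L f_n`
  have hfe : ∀ y, Tendsto (fun n => f n y) atTop (𝓝 (e y)) := fun y => by
    refine tendsto_const_nhds.congr' ?_
    filter_upwards [hev y] with n hn
    rw [hfdef, hn, mul_one]
  have hfℓ : ∀ y, Tendsto (fun n => (pinnedChain ω₂ lam β γ).generator N T T (f n) y) atTop (𝓝 (ℓ y)) := by
    intro y
    have hg : Tendsto (fun n : ℕ => smoothCutoff ((pinnedChain ω₂ lam β γ).hamiltonian N y / (n + 1)) * ℓ y)
        atTop (𝓝 (ℓ y)) := by
      refine tendsto_const_nhds.congr' ?_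
      filter_upwards [hev y] with n hn
      rw [hn, one_mul]
    have hd : Tendsto (fun n : ℕ => (pinnedChain ω₂ lam β γ).generator N T T (f n) y -
        smoothCutoff ((pinnedChain ω₂ lam β γ).hamiltonian N y / (n + 1)) * ℓ y) atTop (𝓝 0) := by
      have hCn : Tendsto (fun n : ℕ => A / (n + 1) * (1 + (pinnedChain ω₂ lam β γ).hamiltonian N y) ^ 2)
          atTop (𝓝 0) := by
        have h1 : Tendsto (fun n : ℕ => A / ((n : ℝ) + 1)) atTop (𝓝 0) :=
          tendsto_const_nhds.div_atTop (tendsto_natCast_atTop_atTop.atTop_add tendsto_const_nhds)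
        simpa using h1.mul_const ((1 + (pinnedChain ω₂ lam β γ).hamiltonian N y) ^ 2)
      exact squeeze_zero_norm (fun n => by rw [Real.norm_eq_abs]; exact herr n y) hCn
    have := hd.add hg
    simpa using this
  exact pinnedChain_dynkin_of_truncation hω hl.le hβ hγ hN0 hT hθ0 hθ1 f hf2 hfs hfe hfℓ hfb hLb r z

end Summit.AtomisticToContinuum.FouriersLaw.Theorems.OddSectorIrreversibility
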